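import Mathlib
import Literature.NumberTheory.Transcendental.PeriodsWave0
import Literature.NumberTheory.Transcendental.KZProduct
import Literature.NumberTheory.Transcendental.KZRulesAssociator
import Literature.Barriers.KontsevichZagierPeriods.GrothendieckPeriodConjectureDependenceOddZetaProofs
import Summits.KontsevichZagierPeriods.KontsevichZagierPeriods.Theorems.SoloInformedVolumeLadder
import Summits.KontsevichZagierPeriods.KontsevichZagierPeriods.Theorems.SoloInformedLadderSplit
import Summits.KontsevichZagierPeriods.KontsevichZagierPeriods.Theorems.SoloInformedEtaIntegral
import Summits.KontsevichZagierPeriods.KontsevichZagierPeriods.Theorems.SoloInformedLastDilation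
import Summits.KontsevichZagierPeriods.KontsevichZagierPeriods.Theorems.SoloInformedSubgraph
import Summits.KontsevichZagierPeriods.KontsevichZagierPeriods.Theorems.SoloInformedWallFaces
import HarnessLib
import HarnessLib.Audit

/-!
# SoloInformed — parity faces: `ζ(3)/π³ ∉ ℚ` at `LocRung₄` and `G/π² ∉ ℚ` at `Rung₃`

`SoloInformedWallFaces` compared a sub-graph solid `E_q ⊂ [0,1]ⁿ⁺¹` with the CUBE and found, under
the volume rung `Rung_{n+1}`, that "no move certificate" is exactly "`vol E_q ∉ ℚ`".  Here two
sub-graph solids `E_{q₁}, E_{q₂} ⊂ [0,1]ⁿ⁺¹` are compared with EACH OTHER, and the comparison is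
LOCALISED at `⟦[π]⟧` (the formally stronger no-relation, the weaker rung `LocRung_{n+1}` of
`SoloInformedLadderSplit`):

* (`soloInformed_locRung_subgraphNoLocRelation_iff`) **`LocRung_{n+1} → (NoLocRel(q₁,q₂) ↔
  vol E_{q₁} / vol E_{q₂} ∉ ℚ)`**, where `NoLocRel(q₁,q₂)` says that no `N` and no positive integers
  `a, b` give `⟦[π]⟧ᴺ · ⟦a·[E_{q₁}] − b·[E_{q₂}]⟧ = 0` in the formal period ring; the unconditional
  half `vol E_{q₁}/vol E_{q₂} ∉ ℚ → NoLocRel` is `soloInformed_subgraphNoLocRelation_of_irrational`.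

The second solid is the **arctangent solid** `A_n = E_{∏(1+xᵢ²)}` of volume `(π/4)ⁿ`
(`soloInformed_value_atanSolid`), a power of `π` realised INSIDE `[0,1]ⁿ⁺¹` with integrand `1`.
Instances (`E_η(n) = E_{1+x₀⋯x_{n−1}}`, volume `(1 − 2^{1−n}) ζ(n)`; `E_G`, volume Catalan's `G`):

* **`LocRung_{n+1} → (NoLocRel(η_n, A_n) ↔ ζ(n)/πⁿ ∉ ℚ)`** (`n ≥ 2`); at `n = 3`:
  **`LocRung₄ → (NoLocRel(η₃, A₃) ↔ ζ(3)/π³ ∉ ℚ)`** — the irrationality of `ζ(3)/π³` is OPEN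
  ("It remains open whether `ζ(3)` is transcendental, or even whether `ζ(3)/π³` is irrational",
  [Finch 2003, §1.6.1 p. 41]);
* the EVEN control `n = 2k`: `ζ(2k)/π^{2k} ∈ ℚ` (Euler), so `LocRung_{2k+1}` PRODUCES a localised
  certificate `⟦[π]⟧ᴺ·⟦a·[E_η(2k)] − b·[A_{2k}]⟧ = 0` (`soloInformed_locRung_exists_locRelation_eta_even`);
* **`LocRung₃ → (NoLocRel(G, A₂) ↔ G/π² ∉ ℚ)`**, hence under `Rung₃` — "We also know nothing about
  the arithmetic character of `G/π²`" [Finch 2003, §1.7 p. 53].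

So the first open rung `Rung₃` has the face `G/π² ∉ ℚ` and the localised rung `LocRung₄` the face
`ζ(3)/π³ ∉ ℚ`, each equivalent (granted the rung) to an explicit no-certificate statement between two
solids in one cube.  The residency's paper (§3ter) proves `NoLocRel(η_n, A_n)` for ODD `n` and
`NoLocRel(G, A₂)` outside the kernel, from a SIGN invariant (the action of complex conjugation on the
top weight-graded piece of the Betti realisation: `+1` on `A_n`, `(−1)ⁿ` on `E_η(n)`, `−1` on `E_G`),
which is why the parity of `n` decides; the kernel content here is the exact equivalence at each rung.

Residency `solo-KontsevichZagierPeriods-informed` (PLAN.md, session s19).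
References: M. Kontsevich, D. Zagier, *Periods* (2001), §1.2; S. R. Finch, *Mathematical
constants* (CUP 2003), §§1.6–1.7; M. Waldschmidt, *Open Diophantine problems*, Moscow Math. J. 4
(2004), §3.
-/

noncomputable section

open MeasureTheory Set Filter
open scoped Topology

namespace Summit.KontsevichZagierPeriods.KontsevichZagierPeriods.Theorems

open Literature.NumberTheory.Transcendental Literature.NumberTheory.Transcendental.KZ

variable {n : ℕ}

/-! ### Generic: localised no-relation between two sub-graph solids -/

section Generic

variable (q₁ q₂ : MvPolynomial (Fin n) ℚ) (hq₁ : ∀ x ∈ KZ.cube n, (1 : ℝ) ≤ MvPolynomial.aeval x q₁)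
  (hq₂ : ∀ x ∈ KZ.cube n, (1 : ℝ) ≤ MvPolynomial.aeval x q₂)

/-- The evaluation of `a·[E_{q₁}] − b·[E_{q₂}]` is `a · vol E_{q₁} − b · vol E_{q₂}`. -/
theorem soloInformed_eval_nsmul_subgraph_sub_nsmul_subgraph (a b : ℕ) :
    eval (a • of (soloInformedSubgraphRep q₁ hq₁) - b • of (soloInformedSubgraphRep q₂ hq₂)) =
      a * (soloInformedSubgraphRep q₁ hq₁).value - b * (soloInformedSubgraphRep q₂ hq₂).value := by
  simp [map_sub, map_nsmul, eval_of, nsmul_eq_mul]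

/-- **Unconditional half.** If `vol E_{q₁} / vol E_{q₂}` is irrational then `NoLocRel(q₁, q₂)` — no
`N` and no positive integers `a, b` give `⟦[π]⟧ᴺ · ⟦a·[E_{q₁}] − b·[E_{q₂}]⟧ = 0` in the formal period
ring `FormalRep ⧸ relations`: apply the evaluation `evalP` and cancel `πᴺ ≠ 0`. -/
theorem soloInformed_subgraphNoLocRelation_of_irrational
    (hirr : Irrational
      ((soloInformedSubgraphRep q₁ hq₁).value / (soloInformedSubgraphRep q₂ hq₂).value))
    (N a b : ℕ) (ha : a ≠ 0) :
    toFormalPeriod (of piRep) ^ N *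
      toFormalPeriod (a • of (soloInformedSubgraphRep q₁ hq₁) - b • of (soloInformedSubgraphRep q₂ hq₂))
        ≠ 0 := by
  intro h0
  have h1 := congrArg evalP h0
  rw [map_mul, map_pow, evalP_toFormalPeriod_of, piRep_value, evalP_toFormalPeriod,
    soloInformed_eval_nsmul_subgraph_sub_nsmul_subgraph, map_zero] at h1
  rcases mul_eq_zero.mp h1 with h2 | h2
  · exact pow_ne_zero N Real.pi_pos.ne' h2
  · have hv₂ := soloInformed_value_subgraphRep_pos q₂ hq₂
    have ha' : (a : ℝ) ≠ 0 := by exact_mod_cast ha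
    refine hirr ⟨(b : ℚ) / a, ?_⟩
    rw [Rat.cast_div, Rat.cast_natCast, Rat.cast_natCast, eq_div_iff hv₂.ne', div_mul_eq_mul_div,
      div_eq_iff ha']
    linarith

/-- **The localised rung produces the certificate.** Under `LocRung_{n+1}`: if
`a · vol E_{q₁} = b · vol E_{q₂}` (`a, b ≥ 1`) then `⟦[π]⟧ᴺ · ⟦a·[E_{q₁}] − b·[E_{q₂}]⟧ = 0` for some
`N` — apply the rung to the equal-volume solids `a ⋆ E_{q₁}`, `b ⋆ E_{q₂}` (integer dilations of the
last coordinate, `SoloInformedLastDilation`) and use `[c ⋆ E] − c·[E] ∈ relations`. -/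
theorem soloInformed_locRung_exists_pi_pow_mul_eq_zero (h : SoloInformedLocVolumeRung (n + 1))
    (a b : ℕ) (ha : a ≠ 0) (hb : b ≠ 0)
    (hv : (a : ℝ) * (soloInformedSubgraphRep q₁ hq₁).value =
      b * (soloInformedSubgraphRep q₂ hq₂).value) :
    ∃ N : ℕ, toFormalPeriod (of piRep) ^ N *
      toFormalPeriod (a • of (soloInformedSubgraphRep q₁ hq₁) - b • of (soloInformedSubgraphRep q₂ hq₂))
        = 0 := by
  have hE₁ := soloInformed_subgraphRep_isVolume q₁ hq₁
  have hE₂ := soloInformed_subgraphRep_isVolume q₂ hq₂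
  have hK₁ : SoloInformedIsVolumeRep
      (soloInformedLastStretchRep (soloInformedSubgraphRep q₁ hq₁) hE₁.1 a) :=
    ⟨isCompact_soloInformedLastStretchRep_domain _ hE₁.1 a,
      soloInformed_interior_lastStretchRep_nonempty _ hE₁.1 a ha hE₁.2.1,
      soloInformedLastStretchRep_integrand _ hE₁.1 a⟩
  have hK₂ : SoloInformedIsVolumeRep
      (soloInformedLastStretchRep (soloInformedSubgraphRep q₂ hq₂) hE₂.1 b) :=
    ⟨isCompact_soloInformedLastStretchRep_domain _ hE₂.1 b,
      soloInformed_interior_lastStretchRep_nonempty _ hE₂.1 b hb hE₂.2.1,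
      soloInformedLastStretchRep_integrand _ hE₂.1 b⟩
  obtain ⟨N, hN⟩ := h _ _ hK₁ hK₂ (by
    rw [soloInformed_value_lastStretchRep _ hE₁.1 hE₁.2.2 a ha,
      soloInformed_value_lastStretchRep _ hE₂.1 hE₂.2.2 b hb, hv])
  have e₁ : toFormalPeriod (of (soloInformedLastStretchRep (soloInformedSubgraphRep q₁ hq₁) hE₁.1 a)) =
      toFormalPeriod (a • of (soloInformedSubgraphRep q₁ hq₁)) :=
    toFormalPeriod_eq_iff.2
      (soloInformed_lastStretchRep_sub_nsmul_mem_relations _ hE₁.1 hE₁.2.2 a ha)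
  have e₂ : toFormalPeriod (of (soloInformedLastStretchRep (soloInformedSubgraphRep q₂ hq₂) hE₂.1 b)) =
      toFormalPeriod (b • of (soloInformedSubgraphRep q₂ hq₂)) :=
    toFormalPeriod_eq_iff.2
      (soloInformed_lastStretchRep_sub_nsmul_mem_relations _ hE₂.1 hE₂.2.2 b hb)
  exact ⟨N, by rw [map_sub, mul_sub, ← e₁, ← e₂, hN, sub_self]⟩

/-- **`LocRung_{n+1} → (NoLocRel(q₁, q₂) ↔ vol E_{q₁} / vol E_{q₂} ∉ ℚ)`.** -/
theorem soloInformed_locRung_subgraphNoLocRelation_iff (h : SoloInformedLocVolumeRung (n + 1)) :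
    (∀ N a b : ℕ, a ≠ 0 → b ≠ 0 →
        toFormalPeriod (of piRep) ^ N *
          toFormalPeriod
            (a • of (soloInformedSubgraphRep q₁ hq₁) - b • of (soloInformedSubgraphRep q₂ hq₂)) ≠ 0) ↔
      Irrational ((soloInformedSubgraphRep q₁ hq₁).value / (soloInformedSubgraphRep q₂ hq₂).value) := by
  refine ⟨fun hno => ?_, fun hirr N a b ha _ =>
    soloInformed_subgraphNoLocRelation_of_irrational q₁ q₂ hq₁ hq₂ hirr N a b ha⟩
  by_contra hrat
  obtain ⟨r, hr⟩ : (soloInformedSubgraphRep q₁ hq₁).value / (soloInformedSubgraphRep q₂ hq₂).value ∈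
      Set.range ((↑) : ℚ → ℝ) := not_not.1 hrat
  have h₁ := soloInformed_value_subgraphRep_pos q₁ hq₁
  have h₂ := soloInformed_value_subgraphRep_pos q₂ hq₂
  have hr0 : 0 < r := by
    have h0 : (0 : ℝ) < r := by
      rw [hr]
      exact div_pos h₁ h₂
    exact_mod_cast h0
  have hnum : 0 < r.num := Rat.num_pos.2 hr0
  have hcast : ((r.num.toNat : ℕ) : ℝ) = (r.num : ℝ) := by
    rw [← Int.cast_natCast, Int.toNat_of_nonneg hnum.le]
  have hden : (r.den : ℝ) ≠ 0 := by exact_mod_cast r.den_nz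
  have hv : (soloInformedSubgraphRep q₁ hq₁).value = (r : ℝ) * (soloInformedSubgraphRep q₂ hq₂).value := by
    rw [hr, div_mul_cancel₀ _ h₂.ne']
  have e : (r.den : ℝ) * (r : ℝ) = r.num := by
    rw [Rat.cast_def]
    field_simp
  obtain ⟨N, hN⟩ := soloInformed_locRung_exists_pi_pow_mul_eq_zero q₁ q₂ hq₁ hq₂ h r.den r.num.toNat
    r.den_nz (by omega) (by rw [hcast, hv, ← mul_assoc, e])
  exact hno N r.den r.num.toNat r.den_nz (by omega) hN

/-- `Rung_{n+1} → (NoLocRel(q₁, q₂) ↔ vol E_{q₁} / vol E_{q₂} ∉ ℚ)` (`Rung ⇒ LocRung`). -/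
theorem soloInformed_rung_subgraphNoLocRelation_iff (h : SoloInformedVolumeRung (n + 1)) :
    (∀ N a b : ℕ, a ≠ 0 → b ≠ 0 →
        toFormalPeriod (of piRep) ^ N *
          toFormalPeriod
            (a • of (soloInformedSubgraphRep q₁ hq₁) - b • of (soloInformedSubgraphRep q₂ hq₂)) ≠ 0) ↔
      Irrational ((soloInformedSubgraphRep q₁ hq₁).value / (soloInformedSubgraphRep q₂ hq₂).value) :=
  soloInformed_locRung_subgraphNoLocRelation_iff q₁ q₂ hq₁ hq₂ (soloInformed_locVolumeRung_of_volumeRung h)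

end Generic

/-! ### The arctangent solid `A_n = E_{∏ (1 + xᵢ²)}`, volume `(π/4)ⁿ` -/

/-- `∏ᵢ (1 + xᵢ²) ∈ ℚ[x₀, …, x_{n−1}]`. -/
def soloInformedAtanPoly (n : ℕ) : MvPolynomial (Fin n) ℚ := ∏ i, (1 + MvPolynomial.X i ^ 2)

/-- `(∏ᵢ (1 + xᵢ²))(x) = ∏ᵢ (1 + xᵢ²)`. -/
@[simp] theorem soloInformed_aeval_atanPoly (x : Fin n → ℝ) :
    (MvPolynomial.aeval x (soloInformedAtanPoly n) : ℝ) = ∏ i, (1 + x i ^ 2) := by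
  simp [soloInformedAtanPoly, map_prod]

/-- `∏ᵢ (1 + xᵢ²) ≥ 1`. -/
theorem soloInformed_atanPoly_ge_one (n : ℕ) :
    ∀ x ∈ KZ.cube n, (1 : ℝ) ≤ MvPolynomial.aeval x (soloInformedAtanPoly n) := by
  intro x _
  rw [soloInformed_aeval_atanPoly]
  calc (1 : ℝ) = ∏ _i : Fin n, (1 : ℝ) := Finset.prod_const_one.symm
    _ ≤ ∏ i, (1 + x i ^ 2) :=
      Finset.prod_le_prod (fun _ _ => zero_le_one) fun i _ => by nlinarith [sq_nonneg (x i)]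

/-- **The arctangent solid `A_n = {(x, t) ∈ [0,1]ⁿ⁺¹ : t · ∏ᵢ (1 + xᵢ²) ≤ 1}`.** -/
def soloInformedAtanSolid (n : ℕ) : IntegralRep (n + 1) :=
  soloInformedSubgraphRep (soloInformedAtanPoly n) (soloInformed_atanPoly_ge_one n)

/-- `∫₀¹ dt/(1 + t²) = π/4`. -/
theorem soloInformed_integral_Icc_inv_one_add_sq :
    ∫ t in Icc (0 : ℝ) 1, (1 + t ^ 2)⁻¹ = Real.pi / 4 := by
  rw [integral_Icc_eq_integral_Ioc, ← intervalIntegral.integral_of_le zero_le_one]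
  simp

/-- **`vol A_n = (π/4)ⁿ`** (Fubini over the cube and `∫₀¹ dt/(1+t²) = arctan 1 = π/4`). -/
theorem soloInformed_value_atanSolid (n : ℕ) : (soloInformedAtanSolid n).value = (Real.pi / 4) ^ n := by
  rw [soloInformedAtanSolid, soloInformed_value_subgraphRep]
  have e : ∀ x : Fin n → ℝ, ((MvPolynomial.aeval x (soloInformedAtanPoly n) : ℝ))⁻¹ =
      ∏ i, (fun t : ℝ => (1 + t ^ 2)⁻¹) (x i) := fun x => by
    rw [soloInformed_aeval_atanPoly, ← Finset.prod_inv_distrib]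
  simp_rw [e]
  rw [KZ.cube_eq_pi, volume_pi, Measure.restrict_pi_pi,
    integral_fintype_prod_eq_pow (fun t : ℝ => (1 + t ^ 2)⁻¹), Fintype.card_fin,
    soloInformed_integral_Icc_inv_one_add_sq]

/-! ### Face 1: `E_η(n)` against `A_n` — `ζ(n)/πⁿ` -/

/-- `(1 − 2/2ⁿ) ζ(n) / (π/4)ⁿ ∉ ℚ ↔ ζ(n)/πⁿ ∉ ℚ` (`n ≥ 2`; the factor `(1 − 2/2ⁿ)·4ⁿ ∈ ℚˣ`). -/
theorem soloInformed_irrational_eta_div_atan_iff (hn : 2 ≤ n) :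
    Irrational ((1 - 2 / 2 ^ n) * zetaValue n / (Real.pi / 4) ^ n) ↔
      Irrational (zetaValue n / Real.pi ^ n) := by
  have h2 : (2 : ℚ) / 2 ^ n < 1 := by
    rw [div_lt_one (by positivity)]
    calc (2 : ℚ) = 2 ^ 1 := by norm_num
      _ < 2 ^ n := pow_lt_pow_right₀ (by norm_num) (by omega)
  have hq0 : ((1 - 2 / 2 ^ n) * 4 ^ n : ℚ) ≠ 0 := mul_ne_zero (sub_pos.2 h2).ne' (by positivity)
  have e : (1 - 2 / 2 ^ n) * zetaValue n / (Real.pi / 4) ^ n =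
      (((1 - 2 / 2 ^ n) * 4 ^ n : ℚ) : ℝ) * (zetaValue n / Real.pi ^ n) := by
    push_cast
    rw [div_pow]
    field_simp
  rw [e, irrational_ratCast_mul_iff]
  exact ⟨fun h => h.2, fun h => ⟨hq0, h⟩⟩

/-- **`LocRung_{n+1} → (NoLocRel(η_n, A_n) ↔ ζ(n)/πⁿ ∉ ℚ)`** (`n ≥ 2`): under the localised volume
rung of dimension `n + 1`, the irrationality of `ζ(n)/πⁿ` is exactly the non-existence of a localised
move certificate `⟦[π]⟧ᴺ · ⟦a·[E_η(n)] − b·[A_n]⟧ = 0` with `a, b ≥ 1`. -/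
theorem soloInformed_locRung_etaAtanNoLocRelation_iff (hn : 2 ≤ n)
    (h : SoloInformedLocVolumeRung (n + 1)) :
    (∀ N a b : ℕ, a ≠ 0 → b ≠ 0 →
        toFormalPeriod (of piRep) ^ N *
          toFormalPeriod (a • of (soloInformedEtaSolid n) - b • of (soloInformedAtanSolid n)) ≠ 0) ↔
      Irrational (zetaValue n / Real.pi ^ n) := by
  have e := soloInformed_locRung_subgraphNoLocRelation_iff (soloInformedEtaPoly n) (soloInformedAtanPoly n)
    (soloInformed_etaPoly_ge_one n) (soloInformed_atanPoly_ge_one n) h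
  have hv₁ : (soloInformedSubgraphRep (soloInformedEtaPoly n) (soloInformed_etaPoly_ge_one n)).value =
      (1 - 2 / 2 ^ n) * zetaValue n := soloInformed_value_etaSolid hn
  have hv₂ : (soloInformedSubgraphRep (soloInformedAtanPoly n) (soloInformed_atanPoly_ge_one n)).value =
      (Real.pi / 4) ^ n := soloInformed_value_atanSolid n
  rw [hv₁, hv₂, soloInformed_irrational_eta_div_atan_iff hn] at e
  exact e

/-- **Unconditional: `ζ(n)/πⁿ ∉ ℚ → NoLocRel(η_n, A_n)`** (`n ≥ 2`). -/
theorem soloInformed_etaAtan_noLocRelation_of_irrational (hn : 2 ≤ n)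
    (hirr : Irrational (zetaValue n / Real.pi ^ n)) (N a b : ℕ) (ha : a ≠ 0) :
    toFormalPeriod (of piRep) ^ N *
      toFormalPeriod (a • of (soloInformedEtaSolid n) - b • of (soloInformedAtanSolid n)) ≠ 0 := by
  refine soloInformed_subgraphNoLocRelation_of_irrational _ _ _ _ ?_ N a b ha
  rw [show (soloInformedSubgraphRep (soloInformedEtaPoly n) (soloInformed_etaPoly_ge_one n)).value =
      (1 - 2 / 2 ^ n) * zetaValue n from soloInformed_value_etaSolid hn,
    show (soloInformedSubgraphRep (soloInformedAtanPoly n) (soloInformed_atanPoly_ge_one n)).value =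
      (Real.pi / 4) ^ n from soloInformed_value_atanSolid n, soloInformed_irrational_eta_div_atan_iff hn]
  exact hirr

/-- **The even control.** `ζ(2k)/π^{2k} ∈ ℚ` (Euler), so under `LocRung_{2k+1}` (`k ≥ 1`) there IS
a localised certificate `⟦[π]⟧ᴺ · ⟦a·[E_η(2k)] − b·[A_{2k}]⟧ = 0` with `a, b ≥ 1`: the parity of
`n` decides, as the sign invariant of the paper (§3ter) predicts. -/
theorem soloInformed_locRung_exists_locRelation_eta_even {k : ℕ} (hk : 1 ≤ k)
    (h : SoloInformedLocVolumeRung (2 * k + 1)) :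
    ∃ N a b : ℕ, a ≠ 0 ∧ b ≠ 0 ∧
      toFormalPeriod (of piRep) ^ N *
        toFormalPeriod (a • of (soloInformedEtaSolid (2 * k)) - b • of (soloInformedAtanSolid (2 * k)))
          = 0 := by
  by_contra hno
  have hirr := (soloInformed_locRung_etaAtanNoLocRelation_iff (n := 2 * k) (by omega) h).1
    fun N a b ha hb h0 => hno ⟨N, a, b, ha, hb, h0⟩
  obtain ⟨q, -, hq⟩ := Literature.Barriers.KontsevichZagierPeriods.exists_rat_ne_zero_zetaValue_two_mul_eq
    (k := k) (by omega)
  refine hirr ⟨q, ?_⟩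
  rw [hq, mul_div_cancel_right₀ _ (pow_ne_zero _ Real.pi_pos.ne')]

/-- **`ζ(3)/π³ ∉ ℚ`** — OPEN: "It remains open whether `ζ(3)` is transcendental, or even whether
`ζ(3)/π³` is irrational" [Finch 2003, §1.6.1 p. 41]; a consequence of the algebraic independence of
`π, ζ(3), ζ(5), …` (`PiOddZetaAlgebraicIndependent`, periods.S21). -/
@[conjecture] def SoloInformedZetaThreeOverPiCubedIrrational : Prop :=
  Irrational (zetaValue 3 / Real.pi ^ 3)

/-- **`NoLocRel(η₃, A₃)`** (OPEN — under `LocRung₄` equivalent to, and unconditionally implied by,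
`ζ(3)/π³ ∉ ℚ`): no `N` and no positive `a, b` with `⟦[π]⟧ᴺ · ⟦a·[E_η(3)] − b·[A₃]⟧ = 0`, where
`E_η(3) = {t (1 + x₀x₁x₂) ≤ 1}` (volume `(3/4) ζ(3)`) and `A₃ = {t (1+x₀²)(1+x₁²)(1+x₂²) ≤ 1}`
(volume `π³/64`) are solids in `[0,1]⁴`. -/
@[conjecture] def SoloInformedEtaThreeAtanNoLocRelation : Prop :=
  ∀ N a b : ℕ, a ≠ 0 → b ≠ 0 →
    toFormalPeriod (of piRep) ^ N *
      toFormalPeriod (a • of (soloInformedEtaSolid 3) - b • of (soloInformedAtanSolid 3)) ≠ 0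

/-- **Face of `LocRung₄`: `LocRung₄ → (NoLocRel(η₃, A₃) ↔ ζ(3)/π³ ∉ ℚ)`.** -/
theorem soloInformed_locRung_four_etaThreeAtan_iff (h : SoloInformedLocVolumeRung 4) :
    SoloInformedEtaThreeAtanNoLocRelation ↔ SoloInformedZetaThreeOverPiCubedIrrational :=
  soloInformed_locRung_etaAtanNoLocRelation_iff (n := 3) (by norm_num) h

/-- `Rung₄ → (NoLocRel(η₃, A₃) ↔ ζ(3)/π³ ∉ ℚ)`. -/
theorem soloInformed_rung_four_etaThreeAtan_iff (h : SoloInformedVolumeRung 4) :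
    SoloInformedEtaThreeAtanNoLocRelation ↔ SoloInformedZetaThreeOverPiCubedIrrational :=
  soloInformed_locRung_four_etaThreeAtan_iff (soloInformed_locVolumeRung_of_volumeRung h)

/-- `KontsevichZagierPeriods → (NoLocRel(η₃, A₃) ↔ ζ(3)/π³ ∉ ℚ)`. -/
theorem soloInformed_kz_etaThreeAtan_iff (hKZ : KontsevichZagierPeriods) :
    SoloInformedEtaThreeAtanNoLocRelation ↔ SoloInformedZetaThreeOverPiCubedIrrational :=
  soloInformed_locRung_four_etaThreeAtan_iff (soloInformed_locVolumeRung_of_kzp hKZ 4)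

/-- `ζ(3)/π³ ∉ ℚ → NoLocRel(η₃, A₃)`, unconditionally. -/
theorem soloInformed_etaThreeAtan_of_irrational (h : SoloInformedZetaThreeOverPiCubedIrrational) :
    SoloInformedEtaThreeAtanNoLocRelation :=
  fun N a b ha _ => soloInformed_etaAtan_noLocRelation_of_irrational (by norm_num) h N a b ha

/-- **Under the conjecture, the family `ζ(2k+1)/π^{2k+1} ∉ ℚ` (`k ≥ 1`) IS the family of localised
no-relation statements `NoLocRel(η_{2k+1}, A_{2k+1})`.** -/
theorem soloInformed_kz_forall_etaAtan_iff (hKZ : KontsevichZagierPeriods) :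
    (∀ k : ℕ, 1 ≤ k → ∀ N a b : ℕ, a ≠ 0 → b ≠ 0 →
        toFormalPeriod (of piRep) ^ N *
          toFormalPeriod (a • of (soloInformedEtaSolid (2 * k + 1)) -
            b • of (soloInformedAtanSolid (2 * k + 1))) ≠ 0) ↔
      ∀ k : ℕ, 1 ≤ k → Irrational (zetaValue (2 * k + 1) / Real.pi ^ (2 * k + 1)) := by
  refine forall_congr' fun k => imp_congr_right fun hk => ?_
  exact soloInformed_locRung_etaAtanNoLocRelation_iff (by omega)
    (soloInformed_locVolumeRung_of_kzp hKZ _)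

/-! ### Face 2: `E_G` against `A₂` — `G/π²`, a face of `Rung₃` -/

/-- **`G/π² ∉ ℚ`** — OPEN: "it is unknown whether `G` is irrational … We also know nothing about
the arithmetic character of `G/π²`" [Finch 2003, §1.7 p. 53]. -/
@[conjecture] def SoloInformedCatalanOverPiSqIrrational : Prop :=
  Irrational (catalanConstant / Real.pi ^ 2)

/-- **`NoLocRel(G, A₂)`** (OPEN — under `LocRung₃` equivalent to, and unconditionally implied by,
`G/π² ∉ ℚ`): no `N` and no positive `a, b` with `⟦[π]⟧ᴺ · ⟦a·[E_G] − b·[A₂]⟧ = 0`, where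
`E_G = {t (1 + x₀²x₁²) ≤ 1}` (volume `G`) and `A₂ = {t (1+x₀²)(1+x₁²) ≤ 1}` (volume `π²/16`) are
solids in `[0,1]³`. -/
@[conjecture] def SoloInformedCatalanAtanNoLocRelation : Prop :=
  ∀ N a b : ℕ, a ≠ 0 → b ≠ 0 →
    toFormalPeriod (of piRep) ^ N *
      toFormalPeriod (a • of soloInformedCatalanSolid - b • of (soloInformedAtanSolid 2)) ≠ 0

/-- `G / (π/4)² ∉ ℚ ↔ G/π² ∉ ℚ`. -/
theorem soloInformed_irrational_catalan_div_atan_iff :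
    Irrational (catalanConstant / (Real.pi / 4) ^ 2) ↔ Irrational (catalanConstant / Real.pi ^ 2) := by
  have e : catalanConstant / (Real.pi / 4) ^ 2 = ((16 : ℚ) : ℝ) * (catalanConstant / Real.pi ^ 2) := by
    push_cast
    ring
  rw [e, irrational_ratCast_mul_iff]
  exact ⟨fun h => h.2, fun h => ⟨by norm_num, h⟩⟩

/-- **Face of `LocRung₃`: `LocRung₃ → (NoLocRel(G, A₂) ↔ G/π² ∉ ℚ)`.** -/
theorem soloInformed_locRung_three_catalanAtan_iff (h : SoloInformedLocVolumeRung 3) :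
    SoloInformedCatalanAtanNoLocRelation ↔ SoloInformedCatalanOverPiSqIrrational := by
  have e := soloInformed_locRung_subgraphNoLocRelation_iff soloInformedCatalanPoly (soloInformedAtanPoly 2)
    soloInformed_catalanPoly_ge_one (soloInformed_atanPoly_ge_one 2) h
  have hv₁ : (soloInformedSubgraphRep soloInformedCatalanPoly soloInformed_catalanPoly_ge_one).value =
      catalanConstant := soloInformed_value_catalanSolid
  have hv₂ : (soloInformedSubgraphRep (soloInformedAtanPoly 2) (soloInformed_atanPoly_ge_one 2)).value =
      (Real.pi / 4) ^ 2 := soloInformed_value_atanSolid 2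
  rw [hv₁, hv₂, soloInformed_irrational_catalan_div_atan_iff] at e
  exact e

/-- **Face of the first open rung: `Rung₃ → (NoLocRel(G, A₂) ↔ G/π² ∉ ℚ)`.** -/
theorem soloInformed_rung_three_catalanAtan_iff (h : SoloInformedVolumeRung 3) :
    SoloInformedCatalanAtanNoLocRelation ↔ SoloInformedCatalanOverPiSqIrrational :=
  soloInformed_locRung_three_catalanAtan_iff (soloInformed_locVolumeRung_of_volumeRung h)

/-- `KontsevichZagierPeriods → (NoLocRel(G, A₂) ↔ G/π² ∉ ℚ)`. -/
theorem soloInformed_kz_catalanAtan_iff (hKZ : KontsevichZagierPeriods) :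
    SoloInformedCatalanAtanNoLocRelation ↔ SoloInformedCatalanOverPiSqIrrational :=
  soloInformed_locRung_three_catalanAtan_iff (soloInformed_locVolumeRung_of_kzp hKZ 3)

/-- `G/π² ∉ ℚ → NoLocRel(G, A₂)`, unconditionally. -/
theorem soloInformed_catalanAtan_of_irrational (h : SoloInformedCatalanOverPiSqIrrational) :
    SoloInformedCatalanAtanNoLocRelation := by
  intro N a b ha _
  refine soloInformed_subgraphNoLocRelation_of_irrational _ _ _ _ ?_ N a b ha
  rw [show (soloInformedSubgraphRep soloInformedCatalanPoly soloInformed_catalanPoly_ge_one).value =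
      catalanConstant from soloInformed_value_catalanSolid,
    show (soloInformedSubgraphRep (soloInformedAtanPoly 2) (soloInformed_atanPoly_ge_one 2)).value =
      (Real.pi / 4) ^ 2 from soloInformed_value_atanSolid 2, soloInformed_irrational_catalan_div_atan_iff]
  exact h

end Summit.KontsevichZagierPeriods.KontsevichZagierPeriods.Theorems
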